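import Summits.QuantumFields.YangMills.Theorems.FluctuationComparisonRegPrIntLS2BetaCurlBudget
import Summits.QuantumFields.YangMills.Theorems.FluctuationComparisonRegPrIntLS2BetaCoarseCurlRowsRem
import Summits.QuantumFields.YangMills.Theorems.FluctuationComparisonRegPrIntLS2BetaChartReadDescentOntoExpPoint
import Literature.MathematicalPhysics.QuantumFieldTheory.Balaban1983to89.T4ExpWindowSmallField
import Literature.MathematicalPhysics.QuantumFieldTheory.Balaban1983to89.B10Eq18SigmaSU2Window
import HarnessLib

/-!
# S2β · (SCT″-c)₁ G4-i — «THE c₁ CORE ON THE CHART TOWER»: three of ✓`curlBudget_core`'s five letters — (DOM), (DOM₀), (ROWS) (with `ε := 0`, so (EPS) too) —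
# DISCHARGED BY KERNEL from px13 g28's ✓p835604 M-1‴ `rows_LL_tower_of_remainder_K5` and px16 g23's ✓p832898∕✓p833305 junctions, on the QUATERNIONIC chart tower
# `X_n := iΣσ_a(rev (logVec (Ū^n(e^ζU₀)·(Ū^n U₀)⁻¹)))^a` (GLOBAL identity `Ū^n(e^ζU₀) = Θ(X_n)·Ū^n U₀`; M-1‴'s log-chart recursion on the window `‖logVec‖ ≤ 1∕4 < log(4∕3)`)

Cell `ym3-torus` (YM ladder rung R3 = continuum `SU(2)` Yang–Mills on the three-torus at fixed lattice data — a RUNG: NOT d = 4, NOT infinite volume, NOT a mass gap,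
NOT Clay).  Width seat «width 10» `ym3-torus-px10` (gen 26); crux `stmt-QuantumFields-20520`, LINE g18-1 S2β; G4-i (architect px17 g22 2026-08-31T22:12:17Z «YES — named as
offered; it is G4's main assembly step», amendments (1) (T) in O's `M`-binder shape, (2) `w, W` generic — both taken).  `--kind proof --supports stmt-QuantumFields-20520 --as helper`,
count-neutral, DEFINITION-FREE (0 `def`, 0 `instance`, 0 `notation`, 0 `sorry`, default heartbeats).

WHAT IS PROVED (sorry-free).
§1 ★`eq_expChart_logVecChart_mul` — every `SU(2)` pair is a chart pair GLOBALLY (`W c = Θ(X c)·W₁ c`, quaternionic log, lit ✓`expPoint_logVec` + ✓`expPoint_eq_expChart`);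
   ★`logVecChart_eq_logChart` — on `‖logVec g‖ ≤ 1∕4` the quaternionic chart point IS the log chart `Λ(g)` (`1∕4 < log(4∕3) = s_C`, lit ✓`logChart_expChart`, ✓`norm_su2Coord`,
   ✓`norm_rev`); ★`srcM_nonneg`.
§2 ★★★**`curlBudget_of_chartTower`** — FIXED DATA (`F`, `J ≤ K`, `U₀`, `ζ`, read thickness `θr`, `Cst ≥ 0`, C–S weights `w > 0`, `Σ_{j∈Icc 1 n} w_j⁻¹ ≤ W`), the tower `X` given by
   `hXdef` (the quaternionic chart tower above, so the consumer passes `rfl`): HYPOTHESES = (T) «tower-in-chart» in ✓p835698 O's `M`-binder shape VERBATIM but with the window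
   `∀ t ≤ K−J, Mg t ≤ 1∕4` (O's `1∕2` exceeds the `SU(2)` chart radius `log(4∕3)`; `1∕4` is inside) · M-1‴'s (K5)∕(BKG) classes `α δ αp` VERBATIM at `U i := Ū^i U₀`, `r := K − J`
   (+ the two sign letters `α ≥ 0`, `αp ≥ 0`), its corner sizes `M` (per orientation) and its FREE second-order letter `R` (per orientation) VERBATIM for THIS `X` · (SRC) the
   source ENERGY in ROW form `Σ_{i<K−J} w (i+1)·L^{K−J−1−(i+1)}·Σ_{μ<ν}Σ_{y′} (src_{M-1‴}(i+1,y′) + rem(i+1,y′) + 𝟙[i=0]·|Idx|⁻¹Σ_a rem(0, pos_a y′))² ≤ Bsrc`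
   (`rem(i,x) = e^S − 1 − S`, `S` = the four chart norms around `(x; μ,ν)` — the BCH junction remainder, explicit) ⟹
   **`Σ_{t<K−J} L^t·c₁(t) ≤ (2·Cst·κ²νC_b)·(4·L⁻¹·(L^{K−J}·REL) + W·Bsrc)`** (✓`curlBudget_core` with `ρ :=` GROUP size at level `0` (JNC-0), linearised curl + remainder
   above; `ε := 0`, `Eε := 0`).  HOW: (DOM) = ✓`dist1_relPlaq_le_curl_add_rem` at `(V, Z) := (Ū^n U₀, X_n)` after the global tower identity; (DOM₀) = `rfl`; (ROWS) = M-1‴'s rows for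
   the linearised curl (its `hU` by `rfl`, its `hX` by `logVecChart_eq_logChart` under (T)) + the mirror junction ✓`norm_curl_le_dist1_relPlaq_add_rem` at the `0 → 1` step +
   `rem ≥ 0`; (SRC) re-indexed `Icc 1 (K−J) ↔ range (K−J)`.
WHAT IS LEFT for G4 (the (α) assembler ∕ LEAD's knit, by name): (T) ⟸ O's successor at window `1∕4` (px12) or the fibre's α-smallness; the classes ⟸ (K5)∕(BKG)∕histGood; `R` ⟸
✓p834640 (flat) ∕ ✓p835572 C₂ (curved) through the doors (β)(γ) ✓p835880; the ENERGY `Bsrc := C·e^{cα}·purse + βsrc·S′` under (E5).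

HONEST SCOPE.  Identification + re-plumbing over LANDED letters (M-1‴ ✓p835604, junctions ✓p832898∕✓p833305, core ✓p835744, O's shape ✓p835698, lit chart lemmas); nothing of
Bałaban's renormalisation-group analysis is asserted or proved ([Balaban1985Averaging] (19)–(20) p.21, (56)–(58) p.27, Prop. 4 (128)–(135) pp.37–38; [Balaban1987RG1] (0.1)–(0.4),
(0.8), (0.11) pp.251–253 are the printed rows these letters transcribe); (T), the classes, the sizes `M`, the letter `R`, the source ENERGY (SRC), the doors (α)(β)(γ), (iii),
the SUPPLIER KNIT, (ST⁗)∕LOC⁗, h3 are HYPOTHESES or others'; GAP♯∘ (`stub_uniformFibreGapOrbit`, registry `Lines/semiclassical_s2beta.lean` 3732b7df UNTOUCHED, 0∕5), S2β, the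
five registered stubs, crux 20520, 19936, 19200 and `YM3TorusSU2` are NOT proved; no registered stub is closed; rung R3 = SU(2) YM₃ on T³ at fixed lattice data — NOT d = 4, NOT
infinite volume, NOT a mass gap, NOT Clay; the Yang–Mills mass gap is NOT proved.
-/

set_option autoImplicit false

noncomputable section

open scoped Matrix.Norms.L2Operator
open Finset

namespace Summit.QuantumFields.YangMills.Theorems.FluctuationComparisonRegPrIntLS2BetaCurlBudgetOfChartTower

open Literature.MathematicalPhysics.QuantumFieldTheory.Balaban1983to89
open Literature.MathematicalPhysics.QuantumFieldTheory.Balaban1983to89.T4Continuum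
open Literature.MathematicalPhysics.QuantumFieldTheory.Balaban1983to89.T3ContinuumYM3Torus
open Literature.MathematicalPhysics.QuantumFieldTheory.Balaban1983to89.T3LevelShift
open Literature.MathematicalPhysics.QuantumFieldTheory.Balaban1983to89.T3UnitLawDensityEML (ℰp)
open Literature.MathematicalPhysics.QuantumFieldTheory.Balaban1983to89.T4HaarSU2ExpChart (expPoint)
open Literature.MathematicalPhysics.QuantumFieldTheory.Balaban1983to89.T4ExpWindowSmallField (logVec expPoint_logVec)
open Literature.MathematicalPhysics.QuantumFieldTheory.Balaban1983to89.HaarExponentialChart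
open Literature.MathematicalPhysics.QuantumFieldTheory.Balaban1983to89.HaarExponentialChart.IsChartRep
open Literature.MathematicalPhysics.QuantumFieldTheory.Balaban1983to89.BlockAveraging (Idx blockAvg avgFun loopHol blockAvg_avg)
open Literature.MathematicalPhysics.QuantumFieldTheory.Balaban1983to89.ExpMeanLog (expMeanLogSU deltaSU)
open Literature.MathematicalPhysics.QuantumFieldTheory.Balaban1983to89.BlockAveragingEMLLinearisedBackground (covWalkSum)
open Literature.MathematicalPhysics.QuantumFieldTheory.Balaban1983to89.B10Eq47AxialChi (shiftN)
open Literature.MathematicalPhysics.QuantumFieldTheory.Balaban1983to89.B14.Eq22Determines (blockIter)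
open Literature.MathematicalPhysics.QuantumFieldTheory.Balaban1983to89.B10Eq27TorusAxialLog (rel)
open Literature.MathematicalPhysics.QuantumFieldTheory.Balaban1983to89.B10Eq18SigmaSU2 (su2Coord)
open Literature.MathematicalPhysics.QuantumFieldTheory.Balaban1983to89.B10Eq18SigmaSU2Haar (rev norm_rev)
open Literature.MathematicalPhysics.QuantumFieldTheory.Balaban1983to89.B10Eq18SigmaSU2Window (norm_su2Coord)
open Literature.MathematicalPhysics.QuantumLattice (su2Quat)
open Summit.QuantumFields.YangMills.Theorems.FluctuationComparisonRegPrIntLS2BetaChartReadDescentOntoExpPoint (su2Coord_rev_mem_lie expPoint_eq_expChart)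
open Summit.QuantumFields.YangMills.Theorems.FluctuationComparisonRegPrIntLS2BetaCurlBudget (curlBudget_core)
open Summit.QuantumFields.YangMills.Theorems.FluctuationComparisonRegPrIntLS2BetaCurlBudgetEngine (kernelConst_nonneg)
open Summit.QuantumFields.YangMills.Theorems.FluctuationComparisonRegPrIntLS2BetaCoarseCurlRowsRem (rows_LL_tower_of_remainder_K5)
open Summit.QuantumFields.YangMills.Theorems.FluctuationComparisonRegPrIntLS2BetaRelPlaqCurlJunction (dist1_relPlaq_le_curl_add_rem norm_curl_le_dist1_relPlaq_add_rem)

variable (F : T3Family)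

/-! ## §1 The quaternionic chart tower is a log-chart tower -/

/-- ★ Every `SU(2)` pair `(W, W₁)` is a chart pair: `W c = Θ(X c)·W₁ c` with `X c := iΣσ_a(rev (logVec (W c·(W₁ c)⁻¹)))^a` — GLOBALLY (quaternionic logarithm, no window). -/
theorem eq_expChart_logVecChart_mul {P : Params} {j : ℕ} (W W₁ : GaugeField P j (Matrix.specialUnitaryGroup (Fin 2) ℂ)) :
    W = fun c => (isChartRep_specialUnitaryGroup (n := Fin 2)).expChart
      (⟨su2Coord (rev (logVec (su2Quat (W c * (W₁ c)⁻¹)))), su2Coord_rev_mem_lie _⟩ : (specialUnitaryLogChart (Fin 2)).lie) * W₁ c := by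
  funext c
  rw [← expPoint_eq_expChart, expPoint_logVec, inv_mul_cancel_right]

/-- ★ On the window `‖logVec g‖ ≤ 1∕4` the quaternionic chart point IS the log chart: `⟨iΣσ_a(rev (logVec g))^a, _⟩ = Λ(g)` (`1∕4 < log(4∕3) = s_C` for `SU(2)`). -/
theorem logVecChart_eq_logChart (g : Matrix.specialUnitaryGroup (Fin 2) ℂ) (hg : ‖logVec (su2Quat g)‖ ≤ 1 / 4) :
    (⟨su2Coord (rev (logVec (su2Quat g))), su2Coord_rev_mem_lie _⟩ : (specialUnitaryLogChart (Fin 2)).lie) =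
      (isChartRep_specialUnitaryGroup (n := Fin 2)).logChart g := by
  have hρ : (1 / 3 : ℝ) ≤ innerRadius (specialUnitaryLogChart (Fin 2)) := by
    unfold innerRadius; rw [specialUnitaryLogChart_ρ, Fintype.card_fin]; norm_num
  have hrad : (1 / 4 : ℝ) < chartRadius (specialUnitaryLogChart (Fin 2)) := by
    unfold chartRadius
    have h43 : Real.log (4 / 3) ≤ Real.log (1 + innerRadius (specialUnitaryLogChart (Fin 2))) :=
      Real.log_le_log (by norm_num) (by linarith)
    refine lt_of_lt_of_le ?_ h43
    rw [Real.lt_log_iff_exp_lt (by norm_num)]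
    have hb := Real.exp_bound (x := 1 / 4) (by norm_num) (n := 2) (by norm_num)
    have : |Real.exp (1 / 4) - (1 + 1 / 4)| ≤ 3 / 64 := by
      have e : (∑ m ∈ Finset.range 2, (1 / 4 : ℝ) ^ m / m.factorial) = 1 + 1 / 4 := by
        simp [Finset.sum_range_succ]
      rw [e] at hb
      refine hb.trans ?_
      norm_num [Nat.factorial]
    have := (abs_le.1 this).2
    linarith
  have hX : ‖(⟨su2Coord (rev (logVec (su2Quat g))), su2Coord_rev_mem_lie _⟩ : (specialUnitaryLogChart (Fin 2)).lie)‖ <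
      chartRadius (specialUnitaryLogChart (Fin 2)) := by
    refine lt_of_le_of_lt ?_ hrad
    show ‖su2Coord (rev (logVec (su2Quat g)))‖ ≤ 1 / 4
    rw [norm_su2Coord, norm_rev]
    exact hg
  have h := (isChartRep_specialUnitaryGroup (n := Fin 2)).logChart_expChart hX
  rw [← expPoint_eq_expChart, expPoint_logVec] at h
  exact h.symm


/-- ★ M-1‴'s source formula is nonnegative for nonnegative classes and sizes. [cite: Balaban1985Averaging, Prop. 4 (128)-(135) pp.37-38] -/
theorem srcM_nonneg {L ℓ δ α αp M R : ℝ} (hL : 0 ≤ L) (hℓ : 0 ≤ ℓ) (hδ : 0 ≤ δ) (hα : 0 ≤ α) (hαp : 0 ≤ αp) (hM : 0 ≤ M) (hR : 0 ≤ R) :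
    0 ≤ L * (L * (2 * δ * (L + 2 * L + 2) * M)) + 48 * α * (L * M) + (2 * αp * (ℓ * M) + 24 * α * (ℓ * M)) +
      4 * (404 * ℓ * α * M) + 4 * R + 2 * δ * (L ^ 2 * M) := by
  have h1 : 0 ≤ L + 2 * L + 2 := by linarith
  have := mul_nonneg hδ hM
  have := mul_nonneg hα hM
  have := mul_nonneg hαp hM
  positivity

/-! ## §2 The c₁ core on the chart tower -/

/-- ★★★ **THE c₁ CORE ON THE CHART TOWER** — see the module header: (DOM)∕(DOM₀)∕(ROWS)∕(EPS) of ✓`curlBudget_core` discharged from M-1‴ + junctions on the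
quaternionic chart tower; left: (T) tower-in-chart (window `1∕4`), the classes∕sizes∕`R` letters, the source ENERGY (SRC).
[cite: Balaban1985Averaging, (19)-(20) p.21, (58) p.27, Prop. 4 (128)-(135) pp.37-38; Balaban1987RG1, (0.1)-(0.4), (0.8), (0.11) pp.251-253] -/
theorem curlBudget_of_chartTower {J K : ℕ} (hJK : J ≤ K) (θr : ℕ) (Cst : ℝ) (hCst : 0 ≤ Cst)
    (U₀ : GaugeField (F.P K) 0 (Matrix.specialUnitaryGroup (Fin 2) ℂ)) (ζ : PBond (F.P K) 0 → EuclideanSpace ℝ (Fin 3))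
    (w : ℕ → ℝ) (hw : ∀ j, 0 < w j) (W : ℝ) (hW : ∀ n, ∑ j ∈ Finset.Icc 1 n, (w j)⁻¹ ≤ W)
    (X : (i : ℕ) → PBond (F.P K) i → (specialUnitaryLogChart (Fin 2)).lie)
    (hXdef : X = fun (i : ℕ) (b : PBond (F.P K) i) =>
      (⟨su2Coord (rev (logVec (su2Quat (Averaging.iter (fun k => BlockAveraging.blockAvg (P := F.P K) (j := k) ℰp) i (fun ℓ => expPoint (ζ ℓ) * U₀ ℓ : GaugeField (F.P K) 0 (Matrix.specialUnitaryGroup (Fin 2) ℂ)) b * (Averaging.iter (fun k => BlockAveraging.blockAvg (P := F.P K) (j := k) ℰp) i U₀ b)⁻¹)))), su2Coord_rev_mem_lie _⟩ : (specialUnitaryLogChart (Fin 2)).lie))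
    (Mg : ℕ → ℝ) (hMg : ∀ t, t ≤ K - J → ∀ b : PBond (F.P K) t,
      ‖logVec (su2Quat (Averaging.iter (fun k => BlockAveraging.blockAvg (P := F.P K) (j := k) ℰp) t (fun ℓ => expPoint (ζ ℓ) * U₀ ℓ : GaugeField (F.P K) 0 (Matrix.specialUnitaryGroup (Fin 2) ℂ)) b * (Averaging.iter (fun k => BlockAveraging.blockAvg (P := F.P K) (j := k) ℰp) t U₀ b)⁻¹))‖ ≤ Mg t)
    (hMg4 : ∀ t, t ≤ K - J → Mg t ≤ 1 / 4)
    (α δ : ℕ → ℝ) (αp : Fin (F.P K).d → Fin (F.P K).d → ℕ → ℝ)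
    (hα : ∀ i, i < K - J → ∀ (c : PBond (F.P K) (i + 1)) (ι : Idx (F.P K)), dist1 (loopHol (Averaging.iter (fun k => BlockAveraging.blockAvg (P := F.P K) (j := k) ℰp) i U₀) c ι) ≤ α (i + 1))
    (hα24 : ∀ i, i < K - J → α (i + 1) ≤ 1 / 24) (hαδ : ∀ i, i < K - J → α (i + 1) < deltaSU (Fin 2))
    (hα0 : ∀ i, 0 ≤ α i) (hδ : ∀ i, i < K - J → 0 ≤ δ (i + 1)) (hUs : ∀ i, i < K - J → PlaqSmall (δ (i + 1)) (Averaging.iter (fun k => BlockAveraging.blockAvg (P := F.P K) (j := k) ℰp) i U₀))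
    (hαp0 : ∀ μ ν i, 0 ≤ αp μ ν i)
    (hαp : ∀ μ ν : Fin (F.P K).d, μ < ν → ∀ i, i < K - J → ∀ y' : Site (F.P K) (i + 1),
      dist1 (holAt (avgFun (expMeanLogSU (n := Fin 2)) (Averaging.iter (fun k => BlockAveraging.blockAvg (P := F.P K) (j := k) ℰp) i U₀)) (walk y' [((μ, true) : Letter (F.P K).d), (ν, true), (μ, false), (ν, false)])) ≤ αp μ ν (i + 1))
    (M : Fin (F.P K).d → Fin (F.P K).d → (i : ℕ) → Site (F.P K) i → ℝ) (hM : ∀ μ ν i x, 0 ≤ M μ ν i x)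
    (hXM : ∀ μ ν : Fin (F.P K).d, μ < ν → ∀ i, i < K - J → ∀ (y' : Site (F.P K) (i + 1)) (b : PBond (F.P K) i),
      (blockOf b.src = y' ∨ blockOf b.src = y'.shift μ ∨ blockOf b.src = y'.shift ν ∨ blockOf b.src = (y'.shift μ).shift ν) → ‖X i b‖ ≤ M μ ν (i + 1) y')
    (R : Fin (F.P K).d → Fin (F.P K).d → (i : ℕ) → Site (F.P K) i → ℝ) (hR0 : ∀ μ ν i x, 0 ≤ R μ ν i x)
    (hR : ∀ μ ν : Fin (F.P K).d, μ < ν → ∀ i, i < K - J → ∀ (y' : Site (F.P K) (i + 1)) (c : PBond (F.P K) (i + 1)),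
      (c = ⟨y', μ⟩ ∨ c = ⟨y'.shift μ, ν⟩ ∨ c = ⟨y'.shift ν, μ⟩ ∨ c = ⟨y', ν⟩) →
      ‖(((isChartRep_specialUnitaryGroup (n := Fin 2)).logChart (avgFun (expMeanLogSU (n := Fin 2)) (fun b => (isChartRep_specialUnitaryGroup (n := Fin 2)).expChart (X i b) * Averaging.iter (fun k => BlockAveraging.blockAvg (P := F.P K) (j := k) ℰp) i U₀ b) c * (avgFun (expMeanLogSU (n := Fin 2)) (Averaging.iter (fun k => BlockAveraging.blockAvg (P := F.P K) (j := k) ℰp) i U₀) c)⁻¹) : (specialUnitaryLogChart (Fin 2)).lie) : Matrix (Fin 2) (Fin 2) ℂ) -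
        ((fderiv ℝ (fun (A : PBond (F.P K) i → (specialUnitaryLogChart (Fin 2)).lie) (c : PBond (F.P K) (i + 1)) => (isChartRep_specialUnitaryGroup (n := Fin 2)).logChart (avgFun (expMeanLogSU (n := Fin 2)) (fun b => (isChartRep_specialUnitaryGroup (n := Fin 2)).expChart (A b) * Averaging.iter (fun k => BlockAveraging.blockAvg (P := F.P K) (j := k) ℰp) i U₀ b) c * (avgFun (expMeanLogSU (n := Fin 2)) (Averaging.iter (fun k => BlockAveraging.blockAvg (P := F.P K) (j := k) ℰp) i U₀) c)⁻¹)) 0 (X i) c : (specialUnitaryLogChart (Fin 2)).lie) : Matrix (Fin 2) (Fin 2) ℂ)‖ ≤ R μ ν (i + 1) y')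
    (Bsrc : ℝ)
    (hBsrc : ∑ i ∈ Finset.range (K - J), w (i + 1) * (F.L : ℝ) ^ (K - J - 1 - (i + 1)) *
        ∑ μ : Fin (F.P K).d, ∑ ν : Fin (F.P K).d, ∑ y' : Site (F.P K) (i + 1),
          (if μ < ν then
          (((F.P K).L : ℝ) * (((F.P K).L : ℝ) * (2 * δ (i + 1) * (((F.P K).L : ℝ) + 2 * (F.P K).L + 2) * M μ ν (i + 1) y')) + 48 * α (i + 1) * (((F.P K).L : ℝ) * M μ ν (i + 1) y') +
            (2 * αp μ ν (i + 1) * (((((F.P K).d + 2) * (F.P K).L : ℕ) : ℝ) * M μ ν (i + 1) y') + 24 * α (i + 1) * (((((F.P K).d + 2) * (F.P K).L : ℕ) : ℝ) * M μ ν (i + 1) y')) +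
            4 * (404 * ((((F.P K).d + 2) * (F.P K).L : ℕ) : ℝ) * α (i + 1) * M μ ν (i + 1) y') + 4 * R μ ν (i + 1) y' +
            2 * δ (i + 1) * (((F.P K).L : ℝ) ^ 2 * M μ ν (i + 1) y')) +
          (Real.exp (‖X (i + 1) ⟨y', μ⟩‖ + ‖X (i + 1) ⟨(y').shift μ, ν⟩‖ + ‖X (i + 1) ⟨(y').shift ν, μ⟩‖ + ‖X (i + 1) ⟨y', ν⟩‖) - 1 - (‖X (i + 1) ⟨y', μ⟩‖ + ‖X (i + 1) ⟨(y').shift μ, ν⟩‖ + ‖X (i + 1) ⟨(y').shift ν, μ⟩‖ + ‖X (i + 1) ⟨y', ν⟩‖)) +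
          (if i = 0 then ((Fintype.card (Idx (F.P K)) : ℝ)⁻¹ *
            ∑ a ∈ (Finset.univ : Finset (Idx (F.P K))) ×ˢ (Finset.range (F.P K).L ×ˢ Finset.range (F.P K).L),
              (Real.exp (‖X i ⟨(shiftN (shiftN (Site.blockSite y' a.1.1) μ a.2.1) ν a.2.2), μ⟩‖ + ‖X i ⟨((shiftN (shiftN (Site.blockSite y' a.1.1) μ a.2.1) ν a.2.2)).shift μ, ν⟩‖ + ‖X i ⟨((shiftN (shiftN (Site.blockSite y' a.1.1) μ a.2.1) ν a.2.2)).shift ν, μ⟩‖ + ‖X i ⟨(shiftN (shiftN (Site.blockSite y' a.1.1) μ a.2.1) ν a.2.2), ν⟩‖) - 1 - (‖X i ⟨(shiftN (shiftN (Site.blockSite y' a.1.1) μ a.2.1) ν a.2.2), μ⟩‖ + ‖X i ⟨((shiftN (shiftN (Site.blockSite y' a.1.1) μ a.2.1) ν a.2.2)).shift μ, ν⟩‖ + ‖X i ⟨((shiftN (shiftN (Site.blockSite y' a.1.1) μ a.2.1) ν a.2.2)).shift ν, μ⟩‖ + ‖X i ⟨(shiftN (shiftN (Site.blockSite y' a.1.1)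 μ a.2.1) ν a.2.2), ν⟩‖))) else 0)
          else 0) ^ 2 ≤ Bsrc) :
    ∑ t ∈ Finset.range (K - J), (F.L : ℝ) ^ t * (fun t => Cst * ∑ B : PBond (F.P J) 0,
      ‖(fun p : Plaq (F.P K) (K - J - 1 - t) =>
        if ∃ z₀ : Site (F.P K) 0, (blockIter (K - J) z₀ = (bondShift (F.sitesPerDir_eq (m := F.m) (K := J) (j := 0) (m' := F.m) (K' := K) (j' := K - J) (by omega)) B).src ∨
            blockIter (K - J) z₀ = (bondShift (F.sitesPerDir_eq (m := F.m) (K := J) (j := 0) (m' := F.m) (K' := K) (j' := K - J) (by omega)) B).tgt) ∧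
            ∀ κ, (rel (blockIter (K - J - 1 - t) z₀) p.src κ).natAbs ≤ θr
        then dist1 ((GaugeField.plaqHol (Averaging.iter (fun k => BlockAveraging.blockAvg (P := F.P K) (j := k) ℰp) (K - J - 1 - t) U₀) p)⁻¹ *
          GaugeField.plaqHol (Averaging.iter (fun k => BlockAveraging.blockAvg (P := F.P K) (j := k) ℰp) (K - J - 1 - t)
            (fun ℓ => expPoint (ζ ℓ) * U₀ ℓ : GaugeField (F.P K) 0 (Matrix.specialUnitaryGroup (Fin 2) ℂ))) p)
        else 0)‖ ^ 2) t ≤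
      (2 * Cst * (((5 ^ (F.P K).d : ℕ) : ℝ) ^ 2 * (((2 * (θr + 2) + 1) ^ (F.P K).d * 6 : ℕ) : ℝ) *
              (2 * ((((F.P K).L ^ (F.P K).d : ℕ) : ℝ) - 1) / ((((F.P K).L ^ (F.P K).d : ℕ) : ℝ) - 3)))) * (4 * (F.L : ℝ)⁻¹ * ((F.L : ℝ) ^ (K - J) * ∑ p : Plaq (F.P K) 0,
                  (1 - reTr ((GaugeField.plaqHol U₀ p)⁻¹ * GaugeField.plaqHol (fun ℓ => expPoint (ζ ℓ) * U₀ ℓ : GaugeField (F.P K) 0 (Matrix.specialUnitaryGroup (Fin 2) ℂ)) p))) + W * Bsrc) := by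
  have hm : K - J ≤ (F.P K).m + (F.P K).K := by show K - J ≤ F.m + K; omega
  -- (1) the quaternionic chart tower: Ū^n(e^ζU₀) = Θ(X_n)·Ū^n U₀ (GLOBAL), and M-1‴'s recursion (on the window `M ≤ 1∕4`)
  have hstage : ∀ n, Averaging.iter (fun k => BlockAveraging.blockAvg (P := F.P K) (j := k) ℰp) n (fun ℓ => expPoint (ζ ℓ) * U₀ ℓ : GaugeField (F.P K) 0 (Matrix.specialUnitaryGroup (Fin 2) ℂ)) =
      fun c => (isChartRep_specialUnitaryGroup (n := Fin 2)).expChart (X n c) * Averaging.iter (fun k => BlockAveraging.blockAvg (P := F.P K) (j := k) ℰp) n U₀ c := by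
    intro n
    rw [hXdef]
    exact eq_expChart_logVecChart_mul (Averaging.iter (fun k => BlockAveraging.blockAvg (P := F.P K) (j := k) ℰp) n (fun ℓ => expPoint (ζ ℓ) * U₀ ℓ : GaugeField (F.P K) 0 (Matrix.specialUnitaryGroup (Fin 2) ℂ))) (Averaging.iter (fun k => BlockAveraging.blockAvg (P := F.P K) (j := k) ℰp) n U₀)
  have hU : ∀ i, i < K - J → (fun i => Averaging.iter (fun k => BlockAveraging.blockAvg (P := F.P K) (j := k) ℰp) i U₀) (i + 1) =
      avgFun (expMeanLogSU (n := Fin 2)) ((fun i => Averaging.iter (fun k => BlockAveraging.blockAvg (P := F.P K) (j := k) ℰp) i U₀) i) := fun i _ => rfl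
  have hXrec : ∀ i, i < K - J → X (i + 1) = fun c : PBond (F.P K) (i + 1) => (isChartRep_specialUnitaryGroup (n := Fin 2)).logChart
      (avgFun (expMeanLogSU (n := Fin 2)) (fun b => (isChartRep_specialUnitaryGroup (n := Fin 2)).expChart (X i b) * (fun i => Averaging.iter (fun k => BlockAveraging.blockAvg (P := F.P K) (j := k) ℰp) i U₀) i b) c *
        (avgFun (expMeanLogSU (n := Fin 2)) ((fun i => Averaging.iter (fun k => BlockAveraging.blockAvg (P := F.P K) (j := k) ℰp) i U₀) i) c)⁻¹) := by
    intro i hi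
    funext c
    have e0 : (fun b => (isChartRep_specialUnitaryGroup (n := Fin 2)).expChart (X i b) * (fun i => Averaging.iter (fun k => BlockAveraging.blockAvg (P := F.P K) (j := k) ℰp) i U₀) i b) = Averaging.iter (fun k => BlockAveraging.blockAvg (P := F.P K) (j := k) ℰp) i (fun ℓ => expPoint (ζ ℓ) * U₀ ℓ : GaugeField (F.P K) 0 (Matrix.specialUnitaryGroup (Fin 2) ℂ)) := (hstage i).symm
    rw [e0]
    have e1 : avgFun (expMeanLogSU (n := Fin 2)) (Averaging.iter (fun k => BlockAveraging.blockAvg (P := F.P K) (j := k) ℰp) i (fun ℓ => expPoint (ζ ℓ) * U₀ ℓ : GaugeField (F.P K) 0 (Matrix.specialUnitaryGroup (Fin 2) ℂ))) c * (avgFun (expMeanLogSU (n := Fin 2)) ((fun i => Averaging.iter (fun k => BlockAveraging.blockAvg (P := F.P K) (j := k) ℰp) i U₀) i) c)⁻¹ =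
        Averaging.iter (fun k => BlockAveraging.blockAvg (P := F.P K) (j := k) ℰp) (i + 1) (fun ℓ => expPoint (ζ ℓ) * U₀ ℓ : GaugeField (F.P K) 0 (Matrix.specialUnitaryGroup (Fin 2) ℂ)) c * (Averaging.iter (fun k => BlockAveraging.blockAvg (P := F.P K) (j := k) ℰp) (i + 1) U₀ c)⁻¹ := rfl
    rw [e1, ← logVecChart_eq_logChart _ ((hMg (i + 1) (by omega) c).trans (hMg4 (i + 1) (by omega))), hXdef]
  -- (2) M-1‴'s rows for the linearised curl, per orientation
  have hrowlin : ∀ μ ν : Fin (F.P K).d, μ < ν → ∀ i, i < K - J → ∀ y' : Site (F.P K) (i + 1),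
      ‖covWalkSum (Averaging.iter (fun k => BlockAveraging.blockAvg (P := F.P K) (j := k) ℰp) (i + 1) U₀) (fun b => ((X (i + 1) b : (specialUnitaryLogChart (Fin 2)).lie) : Matrix (Fin 2) (Fin 2) ℂ))
          (walk y' [((μ, true) : Letter (F.P K).d), (ν, true), (μ, false), (ν, false)])‖ ≤
        ((Fintype.card (Idx (F.P K)) : ℝ)⁻¹ *
            ∑ a ∈ (Finset.univ : Finset (Idx (F.P K))) ×ˢ (Finset.range (F.P K).L ×ˢ Finset.range (F.P K).L),
              ‖covWalkSum (Averaging.iter (fun k => BlockAveraging.blockAvg (P := F.P K) (j := k) ℰp) i U₀) (fun b => ((X i b : (specialUnitaryLogChart (Fin 2)).lie) : Matrix (Fin 2) (Fin 2) ℂ))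
          (walk (shiftN (shiftN (Site.blockSite y' a.1.1) μ a.2.1) ν a.2.2) [((μ, true) : Letter (F.P K).d), (ν, true), (μ, false), (ν, false)])‖) +
          (((F.P K).L : ℝ) * (((F.P K).L : ℝ) * (2 * δ (i + 1) * (((F.P K).L : ℝ) + 2 * (F.P K).L + 2) * M μ ν (i + 1) y')) + 48 * α (i + 1) * (((F.P K).L : ℝ) * M μ ν (i + 1) y') +
            (2 * αp μ ν (i + 1) * (((((F.P K).d + 2) * (F.P K).L : ℕ) : ℝ) * M μ ν (i + 1) y') + 24 * α (i + 1) * (((((F.P K).d + 2) * (F.P K).L : ℕ) : ℝ) * M μ ν (i + 1) y')) +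
            4 * (404 * ((((F.P K).d + 2) * (F.P K).L : ℕ) : ℝ) * α (i + 1) * M μ ν (i + 1) y') + 4 * R μ ν (i + 1) y' +
            2 * δ (i + 1) * (((F.P K).L : ℝ) ^ 2 * M μ ν (i + 1) y')) := by
    intro μ ν hμν
    exact rows_LL_tower_of_remainder_K5 (P := F.P K) (N := 2) (ne_of_lt hμν) (K - J) hm (fun i => Averaging.iter (fun k => BlockAveraging.blockAvg (P := F.P K) (j := k) ℰp) i U₀) X hU hXrec
      α δ (αp μ ν) hα hα24 hαδ hδ hUs (hαp μ ν hμν) (M μ ν) (fun i _ y' => hM μ ν (i + 1) y') (hXM μ ν hμν) (R μ ν) (hR μ ν hμν) _ _ rfl rfl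
  -- (3) the remainders are nonnegative
  have hrem : ∀ s : ℝ, 0 ≤ Real.exp s - 1 - s := fun s => by linarith [Real.add_one_le_exp s]
  -- (4) the core's five letters for ρ := [level 0: GROUP size; level ≥ 1: linearised curl + BCH remainder]
  have hρ0 : ∀ (μ ν : Fin (F.P K).d) (i : ℕ) (x : Site (F.P K) i), (0 : ℝ) ≤ (fun (μ ν : Fin (F.P K).d) (i : ℕ) (x : Site (F.P K) i) =>
      (if h : μ < ν then (if i = 0 then dist1 ((GaugeField.plaqHol (Averaging.iter (fun k => BlockAveraging.blockAvg (P := F.P K) (j := k) ℰp) i U₀) ⟨x, μ, ν, h⟩)⁻¹ *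
          GaugeField.plaqHol (Averaging.iter (fun k => BlockAveraging.blockAvg (P := F.P K) (j := k) ℰp) i (fun ℓ => expPoint (ζ ℓ) * U₀ ℓ : GaugeField (F.P K) 0 (Matrix.specialUnitaryGroup (Fin 2) ℂ))) ⟨x, μ, ν, h⟩) else ‖covWalkSum (Averaging.iter (fun k => BlockAveraging.blockAvg (P := F.P K) (j := k) ℰp) i U₀) (fun b => ((X i b : (specialUnitaryLogChart (Fin 2)).lie) : Matrix (Fin 2) (Fin 2) ℂ))
          (walk x [((μ, true) : Letter (F.P K).d), (ν, true), (μ, false), (ν, false)])‖ + (Real.exp (‖X i ⟨x, μ⟩‖ + ‖X i ⟨(x).shift μ, ν⟩‖ + ‖X i ⟨(x).shift ν, μ⟩‖ + ‖X i ⟨x, ν⟩‖) - 1 - (‖X i ⟨x, μ⟩‖ + ‖X i ⟨(x).shift μ, ν⟩‖ + ‖X i ⟨(x).shift ν, μ⟩‖ + ‖X i ⟨x, ν⟩‖))) else 0)) μ ν i x := by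
    intro μ ν i x
    beta_reduce
    split_ifs
    · exact GaugeGroup.dist1_nonneg _
    · exact add_nonneg (norm_nonneg _) (hrem _)
    · exact le_rfl
  have hsrc0 : ∀ (μ ν : Fin (F.P K).d) (i : ℕ) (x : Site (F.P K) i), (0 : ℝ) ≤ (fun (μ ν : Fin (F.P K).d) (i : ℕ) =>
      match i with
        | 0 => fun (_ : Site (F.P K) 0) => (0 : ℝ)
        | i' + 1 => fun (y' : Site (F.P K) (i' + 1)) => if i' < K - J then (if μ < ν then
          (((F.P K).L : ℝ) * (((F.P K).L : ℝ) * (2 * δ (i' + 1) * (((F.P K).L : ℝ) + 2 * (F.P K).L + 2) * M μ ν (i' + 1) y')) + 48 * α (i' + 1) * (((F.P K).L : ℝ) * M μ ν (i' + 1) y') +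
            (2 * αp μ ν (i' + 1) * (((((F.P K).d + 2) * (F.P K).L : ℕ) : ℝ) * M μ ν (i' + 1) y') + 24 * α (i' + 1) * (((((F.P K).d + 2) * (F.P K).L : ℕ) : ℝ) * M μ ν (i' + 1) y')) +
            4 * (404 * ((((F.P K).d + 2) * (F.P K).L : ℕ) : ℝ) * α (i' + 1) * M μ ν (i' + 1) y') + 4 * R μ ν (i' + 1) y' +
            2 * δ (i' + 1) * (((F.P K).L : ℝ) ^ 2 * M μ ν (i' + 1) y')) +
          (Real.exp (‖X (i' + 1) ⟨y', μ⟩‖ + ‖X (i' + 1) ⟨(y').shift μ, ν⟩‖ + ‖X (i' + 1) ⟨(y').shift ν, μ⟩‖ + ‖X (i' + 1) ⟨y', ν⟩‖) - 1 - (‖X (i' + 1) ⟨y', μ⟩‖ + ‖X (i' + 1) ⟨(y').shift μ, ν⟩‖ + ‖X (i' + 1) ⟨(y').shift ν, μ⟩‖ + ‖X (i' + 1) ⟨y', ν⟩‖)) +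
          (if i' = 0 then ((Fintype.card (Idx (F.P K)) : ℝ)⁻¹ *
            ∑ a ∈ (Finset.univ : Finset (Idx (F.P K))) ×ˢ (Finset.range (F.P K).L ×ˢ Finset.range (F.P K).L),
              (Real.exp (‖X i' ⟨(shiftN (shiftN (Site.blockSite y' a.1.1) μ a.2.1) ν a.2.2), μ⟩‖ + ‖X i' ⟨((shiftN (shiftN (Site.blockSite y' a.1.1) μ a.2.1) ν a.2.2)).shift μ, ν⟩‖ + ‖X i' ⟨((shiftN (shiftN (Site.blockSite y' a.1.1) μ a.2.1) ν a.2.2)).shift ν, μ⟩‖ + ‖X i' ⟨(shiftN (shiftN (Site.blockSite y' a.1.1) μ a.2.1) ν a.2.2), ν⟩‖) - 1 - (‖X i' ⟨(shiftN (shiftN (Site.blockSite y' a.1.1) μ a.2.1) ν a.2.2), μ⟩‖ + ‖X i' ⟨((shiftN (shiftN (Site.blockSite y' a.1.1) μ a.2.1) ν a.2.2)).shift μ, ν⟩‖ + ‖X i' ⟨((shiftN (shiftN (Site.blockSite y' a.1.1) μ a.2.1) ν a.2.2)).shift ν, μ⟩‖ + ‖X i' ⟨(shiftN (shiftN (Site.blockSite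 y' a.1.1) μ a.2.1) ν a.2.2), ν⟩‖))) else 0)
          else 0) else 0
      : Fin (F.P K).d → Fin (F.P K).d → (i : ℕ) → Site (F.P K) i → ℝ) μ ν i x := by
    intro μ ν i x
    have hc0 : (0 : ℝ) ≤ (Fintype.card (Idx (F.P K)) : ℝ)⁻¹ := inv_nonneg.2 (Nat.cast_nonneg _)
    cases i with
    | zero => exact le_rfl
    | succ i' =>
      simp only
      split_ifs with hi' hμν h0
      · exact add_nonneg (add_nonneg (srcM_nonneg (Nat.cast_nonneg _) (Nat.cast_nonneg _) (hδ i' hi') (hα0 _) (hαp0 μ ν _) (hM μ ν _ x) (hR0 μ ν _ x)) (hrem _))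
          (mul_nonneg hc0 (Finset.sum_nonneg fun a _ => hrem _))
      · exact add_nonneg (add_nonneg (srcM_nonneg (Nat.cast_nonneg _) (Nat.cast_nonneg _) (hδ i' hi') (hα0 _) (hαp0 μ ν _) (hM μ ν _ x) (hR0 μ ν _ x)) (hrem _)) le_rfl
      · exact le_rfl
      · exact le_rfl
  have hdom : ∀ n, n < K - J → ∀ p : Plaq (F.P K) n,
      dist1 ((GaugeField.plaqHol (Averaging.iter (fun k => BlockAveraging.blockAvg (P := F.P K) (j := k) ℰp) n U₀) p)⁻¹ *
          GaugeField.plaqHol (Averaging.iter (fun k => BlockAveraging.blockAvg (P := F.P K) (j := k) ℰp) n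
            (fun ℓ => expPoint (ζ ℓ) * U₀ ℓ : GaugeField (F.P K) 0 (Matrix.specialUnitaryGroup (Fin 2) ℂ))) p) ≤ (fun (μ ν : Fin (F.P K).d) (i : ℕ) (x : Site (F.P K) i) =>
      (if h : μ < ν then (if i = 0 then dist1 ((GaugeField.plaqHol (Averaging.iter (fun k => BlockAveraging.blockAvg (P := F.P K) (j := k) ℰp) i U₀) ⟨x, μ, ν, h⟩)⁻¹ *
          GaugeField.plaqHol (Averaging.iter (fun k => BlockAveraging.blockAvg (P := F.P K) (j := k) ℰp) i (fun ℓ => expPoint (ζ ℓ) * U₀ ℓ : GaugeField (F.P K) 0 (Matrix.specialUnitaryGroup (Fin 2) ℂ))) ⟨x, μ, ν, h⟩) else ‖covWalkSum (Averaging.iter (fun k => BlockAveraging.blockAvg (P := F.P K) (j := k) ℰp) i U₀) (fun b => ((X i b : (specialUnitaryLogChart (Fin 2)).lie) : Matrix (Fin 2) (Fin 2) ℂ))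
          (walk x [((μ, true) : Letter (F.P K).d), (ν, true), (μ, false), (ν, false)])‖ + (Real.exp (‖X i ⟨x, μ⟩‖ + ‖X i ⟨(x).shift μ, ν⟩‖ + ‖X i ⟨(x).shift ν, μ⟩‖ + ‖X i ⟨x, ν⟩‖) - 1 - (‖X i ⟨x, μ⟩‖ + ‖X i ⟨(x).shift μ, ν⟩‖ + ‖X i ⟨(x).shift ν, μ⟩‖ + ‖X i ⟨x, ν⟩‖))) else 0)) p.μ p.ν n p.src := by
    intro n hn p
    beta_reduce
    rw [dif_pos p.hμν]
    by_cases h0 : n = 0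
    · subst h0
      rw [if_pos rfl]
    · rw [if_neg h0]
      have hj := dist1_relPlaq_le_curl_add_rem (P := F.P K) (N := 2) (Averaging.iter (fun k => BlockAveraging.blockAvg (P := F.P K) (j := k) ℰp) n U₀) (X n) p.src p.hμν
      rw [← hstage n] at hj
      exact hj
  have hdom0 : ∀ p : Plaq (F.P K) 0, (fun (μ ν : Fin (F.P K).d) (i : ℕ) (x : Site (F.P K) i) =>
      (if h : μ < ν then (if i = 0 then dist1 ((GaugeField.plaqHol (Averaging.iter (fun k => BlockAveraging.blockAvg (P := F.P K) (j := k) ℰp) i U₀) ⟨x, μ, ν, h⟩)⁻¹ *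
          GaugeField.plaqHol (Averaging.iter (fun k => BlockAveraging.blockAvg (P := F.P K) (j := k) ℰp) i (fun ℓ => expPoint (ζ ℓ) * U₀ ℓ : GaugeField (F.P K) 0 (Matrix.specialUnitaryGroup (Fin 2) ℂ))) ⟨x, μ, ν, h⟩) else ‖covWalkSum (Averaging.iter (fun k => BlockAveraging.blockAvg (P := F.P K) (j := k) ℰp) i U₀) (fun b => ((X i b : (specialUnitaryLogChart (Fin 2)).lie) : Matrix (Fin 2) (Fin 2) ℂ))
          (walk x [((μ, true) : Letter (F.P K).d), (ν, true), (μ, false), (ν, false)])‖ + (Real.exp (‖X i ⟨x, μ⟩‖ + ‖X i ⟨(x).shift μ, ν⟩‖ + ‖X i ⟨(x).shift ν, μ⟩‖ + ‖X i ⟨x, ν⟩‖) - 1 - (‖X i ⟨x, μ⟩‖ + ‖X i ⟨(x).shift μ, ν⟩‖ + ‖X i ⟨(x).shift ν, μ⟩‖ + ‖X i ⟨x, ν⟩‖))) else 0)) p.μ p.ν 0 p.src ≤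
      dist1 ((GaugeField.plaqHol U₀ p)⁻¹ * GaugeField.plaqHol (fun ℓ => expPoint (ζ ℓ) * U₀ ℓ : GaugeField (F.P K) 0 (Matrix.specialUnitaryGroup (Fin 2) ℂ)) p) := by
    intro p
    beta_reduce
    rw [dif_pos p.hμν, if_pos rfl]
    exact le_rfl
  have hrows : ∀ μ ν : Fin (F.P K).d, μ < ν → ∀ i, i < K - J → ∀ y' : Site (F.P K) (i + 1),
      (fun (μ ν : Fin (F.P K).d) (i : ℕ) (x : Site (F.P K) i) =>
      (if h : μ < ν then (if i = 0 then dist1 ((GaugeField.plaqHol (Averaging.iter (fun k => BlockAveraging.blockAvg (P := F.P K) (j := k) ℰp) i U₀) ⟨x, μ, ν, h⟩)⁻¹ *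
          GaugeField.plaqHol (Averaging.iter (fun k => BlockAveraging.blockAvg (P := F.P K) (j := k) ℰp) i (fun ℓ => expPoint (ζ ℓ) * U₀ ℓ : GaugeField (F.P K) 0 (Matrix.specialUnitaryGroup (Fin 2) ℂ))) ⟨x, μ, ν, h⟩) else ‖covWalkSum (Averaging.iter (fun k => BlockAveraging.blockAvg (P := F.P K) (j := k) ℰp) i U₀) (fun b => ((X i b : (specialUnitaryLogChart (Fin 2)).lie) : Matrix (Fin 2) (Fin 2) ℂ))
          (walk x [((μ, true) : Letter (F.P K).d), (ν, true), (μ, false), (ν, false)])‖ + (Real.exp (‖X i ⟨x, μ⟩‖ + ‖X i ⟨(x).shift μ, ν⟩‖ + ‖X i ⟨(x).shift ν, μ⟩‖ + ‖X i ⟨x, ν⟩‖) - 1 - (‖X i ⟨x, μ⟩‖ + ‖X i ⟨(x).shift μ, ν⟩‖ + ‖X i ⟨(x).shift ν, μ⟩‖ + ‖X i ⟨x, ν⟩‖))) else 0)) μ ν (i + 1) y' ≤ ((1 : ℝ) + (fun _ : ℕ => (0 : ℝ)) i) * ((Fintype.card (Idx (F.P K)) : ℝ)⁻¹ *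
            ∑ a ∈ (Finset.univ : Finset (Idx (F.P K))) ×ˢ (Finset.range (F.P K).L ×ˢ Finset.range (F.P K).L),
              (fun (μ ν : Fin (F.P K).d) (i : ℕ) (x : Site (F.P K) i) =>
      (if h : μ < ν then (if i = 0 then dist1 ((GaugeField.plaqHol (Averaging.iter (fun k => BlockAveraging.blockAvg (P := F.P K) (j := k) ℰp) i U₀) ⟨x, μ, ν, h⟩)⁻¹ *
          GaugeField.plaqHol (Averaging.iter (fun k => BlockAveraging.blockAvg (P := F.P K) (j := k) ℰp) i (fun ℓ => expPoint (ζ ℓ) * U₀ ℓ : GaugeField (F.P K) 0 (Matrix.specialUnitaryGroup (Fin 2) ℂ))) ⟨x, μ, ν, h⟩) else ‖covWalkSum (Averaging.iter (fun k => BlockAveraging.blockAvg (P := F.P K) (j := k) ℰp) i U₀) (fun b => ((X i b : (specialUnitaryLogChart (Fin 2)).lie) : Matrix (Fin 2) (Fin 2) ℂ))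
          (walk x [((μ, true) : Letter (F.P K).d), (ν, true), (μ, false), (ν, false)])‖ + (Real.exp (‖X i ⟨x, μ⟩‖ + ‖X i ⟨(x).shift μ, ν⟩‖ + ‖X i ⟨(x).shift ν, μ⟩‖ + ‖X i ⟨x, ν⟩‖) - 1 - (‖X i ⟨x, μ⟩‖ + ‖X i ⟨(x).shift μ, ν⟩‖ + ‖X i ⟨(x).shift ν, μ⟩‖ + ‖X i ⟨x, ν⟩‖))) else 0)) μ ν i (shiftN (shiftN (Site.blockSite y' a.1.1) μ a.2.1) ν a.2.2)) +
        (fun (μ ν : Fin (F.P K).d) (i : ℕ) =>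
      match i with
        | 0 => fun (_ : Site (F.P K) 0) => (0 : ℝ)
        | i' + 1 => fun (y' : Site (F.P K) (i' + 1)) => if i' < K - J then (if μ < ν then
          (((F.P K).L : ℝ) * (((F.P K).L : ℝ) * (2 * δ (i' + 1) * (((F.P K).L : ℝ) + 2 * (F.P K).L + 2) * M μ ν (i' + 1) y')) + 48 * α (i' + 1) * (((F.P K).L : ℝ) * M μ ν (i' + 1) y') +
            (2 * αp μ ν (i' + 1) * (((((F.P K).d + 2) * (F.P K).L : ℕ) : ℝ) * M μ ν (i' + 1) y') + 24 * α (i' + 1) * (((((F.P K).d + 2) * (F.P K).L : ℕ) : ℝ) * M μ ν (i' + 1) y')) +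
            4 * (404 * ((((F.P K).d + 2) * (F.P K).L : ℕ) : ℝ) * α (i' + 1) * M μ ν (i' + 1) y') + 4 * R μ ν (i' + 1) y' +
            2 * δ (i' + 1) * (((F.P K).L : ℝ) ^ 2 * M μ ν (i' + 1) y')) +
          (Real.exp (‖X (i' + 1) ⟨y', μ⟩‖ + ‖X (i' + 1) ⟨(y').shift μ, ν⟩‖ + ‖X (i' + 1) ⟨(y').shift ν, μ⟩‖ + ‖X (i' + 1) ⟨y', ν⟩‖) - 1 - (‖X (i' + 1) ⟨y', μ⟩‖ + ‖X (i' + 1) ⟨(y').shift μ, ν⟩‖ + ‖X (i' + 1) ⟨(y').shift ν, μ⟩‖ + ‖X (i' + 1) ⟨y', ν⟩‖)) +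
          (if i' = 0 then ((Fintype.card (Idx (F.P K)) : ℝ)⁻¹ *
            ∑ a ∈ (Finset.univ : Finset (Idx (F.P K))) ×ˢ (Finset.range (F.P K).L ×ˢ Finset.range (F.P K).L),
              (Real.exp (‖X i' ⟨(shiftN (shiftN (Site.blockSite y' a.1.1) μ a.2.1) ν a.2.2), μ⟩‖ + ‖X i' ⟨((shiftN (shiftN (Site.blockSite y' a.1.1) μ a.2.1) ν a.2.2)).shift μ, ν⟩‖ + ‖X i' ⟨((shiftN (shiftN (Site.blockSite y' a.1.1) μ a.2.1) ν a.2.2)).shift ν, μ⟩‖ + ‖X i' ⟨(shiftN (shiftN (Site.blockSite y' a.1.1) μ a.2.1) ν a.2.2), ν⟩‖) - 1 - (‖X i' ⟨(shiftN (shiftN (Site.blockSite y' a.1.1) μ a.2.1) ν a.2.2), μ⟩‖ + ‖X i' ⟨((shiftN (shiftN (Site.blockSite y' a.1.1) μ a.2.1) ν a.2.2)).shift μ, ν⟩‖ + ‖X i' ⟨((shiftN (shiftN (Site.blockSite y' a.1.1) μ a.2.1) ν a.2.2)).shift ν, μ⟩‖ + ‖X i' ⟨(shiftN (shiftN (Site.blockSite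 y' a.1.1) μ a.2.1) ν a.2.2), ν⟩‖))) else 0)
          else 0) else 0
      : Fin (F.P K).d → Fin (F.P K).d → (i : ℕ) → Site (F.P K) i → ℝ) μ ν (i + 1) y' := by
    intro μ ν hμν i hi y'
    have hlin := hrowlin μ ν hμν i hi y'
    have hc0 : (0 : ℝ) ≤ (Fintype.card (Idx (F.P K)) : ℝ)⁻¹ := inv_nonneg.2 (Nat.cast_nonneg _)
    beta_reduce
    simp only [dif_pos hμν, Nat.succ_ne_zero, if_false, add_zero]
    rw [if_pos hi, if_pos hμν]
    by_cases h0 : i = 0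
    · subst h0
      simp only [if_true]
      -- level 0 → 1: the mirror junction `lin₀ ≤ d₀ + rem₀` pointwise under the dilution mean
      have hpt : ∀ x : Site (F.P K) 0, ‖covWalkSum (Averaging.iter (fun k => BlockAveraging.blockAvg (P := F.P K) (j := k) ℰp) 0 U₀) (fun b => ((X 0 b : (specialUnitaryLogChart (Fin 2)).lie) : Matrix (Fin 2) (Fin 2) ℂ))
          (walk x [((μ, true) : Letter (F.P K).d), (ν, true), (μ, false), (ν, false)])‖ ≤ dist1 ((GaugeField.plaqHol (Averaging.iter (fun k => BlockAveraging.blockAvg (P := F.P K) (j := k) ℰp) 0 U₀) ⟨x, μ, ν, hμν⟩)⁻¹ *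
          GaugeField.plaqHol (Averaging.iter (fun k => BlockAveraging.blockAvg (P := F.P K) (j := k) ℰp) 0 (fun ℓ => expPoint (ζ ℓ) * U₀ ℓ : GaugeField (F.P K) 0 (Matrix.specialUnitaryGroup (Fin 2) ℂ))) ⟨x, μ, ν, hμν⟩) + (Real.exp (‖X 0 ⟨x, μ⟩‖ + ‖X 0 ⟨(x).shift μ, ν⟩‖ + ‖X 0 ⟨(x).shift ν, μ⟩‖ + ‖X 0 ⟨x, ν⟩‖) - 1 - (‖X 0 ⟨x, μ⟩‖ + ‖X 0 ⟨(x).shift μ, ν⟩‖ + ‖X 0 ⟨(x).shift ν, μ⟩‖ + ‖X 0 ⟨x, ν⟩‖)) := by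
        intro x
        have hj := norm_curl_le_dist1_relPlaq_add_rem (P := F.P K) (N := 2) (Averaging.iter (fun k => BlockAveraging.blockAvg (P := F.P K) (j := k) ℰp) 0 U₀) (X 0) x hμν
        rw [← hstage 0] at hj
        exact hj
      have hsum := Finset.sum_le_sum fun a (_ : a ∈ (Finset.univ : Finset (Idx (F.P K))) ×ˢ (Finset.range (F.P K).L ×ˢ Finset.range (F.P K).L)) =>
        hpt (shiftN (shiftN (Site.blockSite y' a.1.1) μ a.2.1) ν a.2.2)
      rw [Finset.sum_add_distrib] at hsum
      have hmul := mul_le_mul_of_nonneg_left hsum hc0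
      rw [mul_add] at hmul
      linarith
    · simp only [h0, if_false]
      have hpt : ∀ x : Site (F.P K) i, ‖covWalkSum (Averaging.iter (fun k => BlockAveraging.blockAvg (P := F.P K) (j := k) ℰp) i U₀) (fun b => ((X i b : (specialUnitaryLogChart (Fin 2)).lie) : Matrix (Fin 2) (Fin 2) ℂ))
          (walk x [((μ, true) : Letter (F.P K).d), (ν, true), (μ, false), (ν, false)])‖ ≤ ‖covWalkSum (Averaging.iter (fun k => BlockAveraging.blockAvg (P := F.P K) (j := k) ℰp) i U₀) (fun b => ((X i b : (specialUnitaryLogChart (Fin 2)).lie) : Matrix (Fin 2) (Fin 2) ℂ))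
          (walk x [((μ, true) : Letter (F.P K).d), (ν, true), (μ, false), (ν, false)])‖ + (Real.exp (‖X i ⟨x, μ⟩‖ + ‖X i ⟨(x).shift μ, ν⟩‖ + ‖X i ⟨(x).shift ν, μ⟩‖ + ‖X i ⟨x, ν⟩‖) - 1 - (‖X i ⟨x, μ⟩‖ + ‖X i ⟨(x).shift μ, ν⟩‖ + ‖X i ⟨(x).shift ν, μ⟩‖ + ‖X i ⟨x, ν⟩‖)) := fun x => le_add_of_nonneg_right (hrem _)
      have hsum := Finset.sum_le_sum fun a (_ : a ∈ (Finset.univ : Finset (Idx (F.P K))) ×ˢ (Finset.range (F.P K).L ×ˢ Finset.range (F.P K).L)) =>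
        hpt (shiftN (shiftN (Site.blockSite y' a.1.1) μ a.2.1) ν a.2.2)
      have hmul := mul_le_mul_of_nonneg_left hsum hc0
      linarith
  -- (5) the source energy, re-indexed from rows `i ↦ i + 1` to levels `j ∈ Icc 1 (K − J)`
  have hBsrc' : ∑ j ∈ Finset.Icc 1 (K - J), w j * (F.L : ℝ) ^ (K - J - 1 - j) *
      ∑ μ : Fin (F.P K).d, ∑ ν : Fin (F.P K).d, ∑ c : Site (F.P K) j, (fun (μ ν : Fin (F.P K).d) (i : ℕ) =>
      match i with
        | 0 => fun (_ : Site (F.P K) 0) => (0 : ℝ)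
        | i' + 1 => fun (y' : Site (F.P K) (i' + 1)) => if i' < K - J then (if μ < ν then
          (((F.P K).L : ℝ) * (((F.P K).L : ℝ) * (2 * δ (i' + 1) * (((F.P K).L : ℝ) + 2 * (F.P K).L + 2) * M μ ν (i' + 1) y')) + 48 * α (i' + 1) * (((F.P K).L : ℝ) * M μ ν (i' + 1) y') +
            (2 * αp μ ν (i' + 1) * (((((F.P K).d + 2) * (F.P K).L : ℕ) : ℝ) * M μ ν (i' + 1) y') + 24 * α (i' + 1) * (((((F.P K).d + 2) * (F.P K).L : ℕ) : ℝ) * M μ ν (i' + 1) y')) +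
            4 * (404 * ((((F.P K).d + 2) * (F.P K).L : ℕ) : ℝ) * α (i' + 1) * M μ ν (i' + 1) y') + 4 * R μ ν (i' + 1) y' +
            2 * δ (i' + 1) * (((F.P K).L : ℝ) ^ 2 * M μ ν (i' + 1) y')) +
          (Real.exp (‖X (i' + 1) ⟨y', μ⟩‖ + ‖X (i' + 1) ⟨(y').shift μ, ν⟩‖ + ‖X (i' + 1) ⟨(y').shift ν, μ⟩‖ + ‖X (i' + 1) ⟨y', ν⟩‖) - 1 - (‖X (i' + 1) ⟨y', μ⟩‖ + ‖X (i' + 1) ⟨(y').shift μ, ν⟩‖ + ‖X (i' + 1) ⟨(y').shift ν, μ⟩‖ + ‖X (i' + 1) ⟨y', ν⟩‖)) +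
          (if i' = 0 then ((Fintype.card (Idx (F.P K)) : ℝ)⁻¹ *
            ∑ a ∈ (Finset.univ : Finset (Idx (F.P K))) ×ˢ (Finset.range (F.P K).L ×ˢ Finset.range (F.P K).L),
              (Real.exp (‖X i' ⟨(shiftN (shiftN (Site.blockSite y' a.1.1) μ a.2.1) ν a.2.2), μ⟩‖ + ‖X i' ⟨((shiftN (shiftN (Site.blockSite y' a.1.1) μ a.2.1) ν a.2.2)).shift μ, ν⟩‖ + ‖X i' ⟨((shiftN (shiftN (Site.blockSite y' a.1.1) μ a.2.1) ν a.2.2)).shift ν, μ⟩‖ + ‖X i' ⟨(shiftN (shiftN (Site.blockSite y' a.1.1) μ a.2.1) ν a.2.2), ν⟩‖) - 1 - (‖X i' ⟨(shiftN (shiftN (Site.blockSite y' a.1.1) μ a.2.1) ν a.2.2), μ⟩‖ + ‖X i' ⟨((shiftN (shiftN (Site.blockSite y' a.1.1) μ a.2.1) ν a.2.2)).shift μ, ν⟩‖ + ‖X i' ⟨((shiftN (shiftN (Site.blockSite y' a.1.1) μ a.2.1) ν a.2.2)).shift ν, μ⟩‖ + ‖X i' ⟨(shiftN (shiftN (Site.blockSite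 y' a.1.1) μ a.2.1) ν a.2.2), ν⟩‖))) else 0)
          else 0) else 0
      : Fin (F.P K).d → Fin (F.P K).d → (i : ℕ) → Site (F.P K) i → ℝ) μ ν j c ^ 2 ≤ Bsrc := by
    have e : ∀ gj : ℕ → ℝ, ∑ j ∈ Finset.Icc 1 (K - J), gj j = ∑ i ∈ Finset.range (K - J), gj (i + 1) := by
      intro gj
      rw [Finset.range_eq_Ico, Finset.sum_Ico_add' gj 0 (K - J) 1, zero_add, Finset.Ico_add_one_right_eq_Icc]
    rw [e]
    refine le_of_eq_of_le ?_ hBsrc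
    refine Finset.sum_congr rfl fun i hi => ?_
    rw [Finset.mem_range] at hi
    congr 1
    refine Finset.sum_congr rfl fun μ _ => Finset.sum_congr rfl fun ν _ => Finset.sum_congr rfl fun y' _ => ?_
    simp only [if_pos hi]
  -- (6) the core
  have key := curlBudget_core F hJK θr Cst hCst U₀ ζ w hw W hW
    (fun (μ ν : Fin (F.P K).d) (i : ℕ) (x : Site (F.P K) i) =>
      (if h : μ < ν then (if i = 0 then dist1 ((GaugeField.plaqHol (Averaging.iter (fun k => BlockAveraging.blockAvg (P := F.P K) (j := k) ℰp) i U₀) ⟨x, μ, ν, h⟩)⁻¹ *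
          GaugeField.plaqHol (Averaging.iter (fun k => BlockAveraging.blockAvg (P := F.P K) (j := k) ℰp) i (fun ℓ => expPoint (ζ ℓ) * U₀ ℓ : GaugeField (F.P K) 0 (Matrix.specialUnitaryGroup (Fin 2) ℂ))) ⟨x, μ, ν, h⟩) else ‖covWalkSum (Averaging.iter (fun k => BlockAveraging.blockAvg (P := F.P K) (j := k) ℰp) i U₀) (fun b => ((X i b : (specialUnitaryLogChart (Fin 2)).lie) : Matrix (Fin 2) (Fin 2) ℂ))
          (walk x [((μ, true) : Letter (F.P K).d), (ν, true), (μ, false), (ν, false)])‖ + (Real.exp (‖X i ⟨x, μ⟩‖ + ‖X i ⟨(x).shift μ, ν⟩‖ + ‖X i ⟨(x).shift ν, μ⟩‖ + ‖X i ⟨x, ν⟩‖) - 1 - (‖X i ⟨x, μ⟩‖ + ‖X i ⟨(x).shift μ, ν⟩‖ + ‖X i ⟨(x).shift ν, μ⟩‖ + ‖X i ⟨x, ν⟩‖))) else 0))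
    (fun (μ ν : Fin (F.P K).d) (i : ℕ) =>
      match i with
        | 0 => fun (_ : Site (F.P K) 0) => (0 : ℝ)
        | i' + 1 => fun (y' : Site (F.P K) (i' + 1)) => if i' < K - J then (if μ < ν then
          (((F.P K).L : ℝ) * (((F.P K).L : ℝ) * (2 * δ (i' + 1) * (((F.P K).L : ℝ) + 2 * (F.P K).L + 2) * M μ ν (i' + 1) y')) + 48 * α (i' + 1) * (((F.P K).L : ℝ) * M μ ν (i' + 1) y') +
            (2 * αp μ ν (i' + 1) * (((((F.P K).d + 2) * (F.P K).L : ℕ) : ℝ) * M μ ν (i' + 1) y') + 24 * α (i' + 1) * (((((F.P K).d + 2) * (F.P K).L : ℕ) : ℝ) * M μ ν (i' + 1) y')) +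
            4 * (404 * ((((F.P K).d + 2) * (F.P K).L : ℕ) : ℝ) * α (i' + 1) * M μ ν (i' + 1) y') + 4 * R μ ν (i' + 1) y' +
            2 * δ (i' + 1) * (((F.P K).L : ℝ) ^ 2 * M μ ν (i' + 1) y')) +
          (Real.exp (‖X (i' + 1) ⟨y', μ⟩‖ + ‖X (i' + 1) ⟨(y').shift μ, ν⟩‖ + ‖X (i' + 1) ⟨(y').shift ν, μ⟩‖ + ‖X (i' + 1) ⟨y', ν⟩‖) - 1 - (‖X (i' + 1) ⟨y', μ⟩‖ + ‖X (i' + 1) ⟨(y').shift μ, ν⟩‖ + ‖X (i' + 1) ⟨(y').shift ν, μ⟩‖ + ‖X (i' + 1) ⟨y', ν⟩‖)) +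
          (if i' = 0 then ((Fintype.card (Idx (F.P K)) : ℝ)⁻¹ *
            ∑ a ∈ (Finset.univ : Finset (Idx (F.P K))) ×ˢ (Finset.range (F.P K).L ×ˢ Finset.range (F.P K).L),
              (Real.exp (‖X i' ⟨(shiftN (shiftN (Site.blockSite y' a.1.1) μ a.2.1) ν a.2.2), μ⟩‖ + ‖X i' ⟨((shiftN (shiftN (Site.blockSite y' a.1.1) μ a.2.1) ν a.2.2)).shift μ, ν⟩‖ + ‖X i' ⟨((shiftN (shiftN (Site.blockSite y' a.1.1) μ a.2.1) ν a.2.2)).shift ν, μ⟩‖ + ‖X i' ⟨(shiftN (shiftN (Site.blockSite y' a.1.1) μ a.2.1) ν a.2.2), ν⟩‖) - 1 - (‖X i' ⟨(shiftN (shiftN (Site.blockSite y' a.1.1) μ a.2.1) ν a.2.2), μ⟩‖ + ‖X i' ⟨((shiftN (shiftN (Site.blockSite y' a.1.1) μ a.2.1) ν a.2.2)).shift μ, ν⟩‖ + ‖X i' ⟨((shiftN (shiftN (Site.blockSite y' a.1.1) μ a.2.1) ν a.2.2)).shift ν, μ⟩‖ + ‖X i' ⟨(shiftN (shiftN (Site.blockSite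 y' a.1.1) μ a.2.1) ν a.2.2), ν⟩‖))) else 0)
          else 0) else 0
      : Fin (F.P K).d → Fin (F.P K).d → (i : ℕ) → Site (F.P K) i → ℝ)
    (fun _ => 0) hρ0 hsrc0 (fun _ => le_rfl) hdom hdom0 hrows 0 (by simp) Bsrc hBsrc'
  rw [Real.exp_zero, one_mul] at key
  exact key

end Summit.QuantumFields.YangMills.Theorems.FluctuationComparisonRegPrIntLS2BetaCurlBudgetOfChartTower

end
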